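import Literature.NumberTheory.DiophantineGeometry.GenEllDivisorConductor
import Literature.NumberTheory.DiophantineGeometry.GenEllConductorDifferent
import Mathlib.NumberTheory.RamificationInertia.Valuation
import HarnessLib

/-!
# [GenEll] Proposition 1.7 (i), left inequality, for finite maps `φ : ℙ¹ → ℙ¹`

S. Mochizuki, *Arithmetic elliptic curves in general position*, Math. J. Okayama Univ. 52 (2010)
[cite: MochizukiGenEll2010], Proposition 1.7 (i) pp. 9–10, read on the page: for a generically
finite morphism `φ : Y → Z` of normal `ℤ`-proper `ℤ`-flat surfaces and `ℤ`-flat divisors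
`D ⊆ Y`, `E ⊆ Z` with `D_ℚ = φ⁻¹(E_ℚ)_red`, restricting functions on `U_Z(Q̄)` to `U_Y(Q̄)` via `φ`,
`log-cond_E − log-cond_D ≲ log-diff_Y − log-diff_Z ≲ (1 − 1/e)·log-cond_E`.

This file PROVES the LEFT inequality in the case the proof of [GenEll] Thm. 2.1 applies it ("where we
take `e` to be `1`", p. 13) specialised to the vocabulary the tree has: `Y = Z = ℙ¹_ℚ` with model
`ℙ¹_ℤ`, `E = C = [0]+[1]+[∞]`, `φ = f/g` a finite map given by `f, g ∈ ℤ[t]` of degree `≤ n`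
(the form `(F : G)` of degree `n`), and `D` the pullback divisor `φ*C = V(F·G·(F−G))` (degree `3n`;
its reduction is `φ⁻¹(C)_red`, and the conductor `(D_y)_red` of Def. 1.5 (iv) only sees the support,
so `log-cond_D = log-cond_{φ⁻¹(C)_red}`). The left inequality needs NO étaleness of `φ` over `U_P`
and NO exceptional primes, and holds with constant `0`:

* `P1FiniteMap`, `P1FiniteMap.pullbackCusps` — the data `(f, g, n)` and the divisor `φ*C` as a
  `P1Divisor` (`GenEllDivisorConductor`);
* `NFPoint.mem_condSupportDiv_pullbackCusps` — **the geometric input**: if `x = φ(y)` meets `C` at a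
  prime `w` of `ℚ(y) ⊇ ℚ(x)` (i.e. at the prime `w ∩ ℚ(x)` below it), then `y` meets `φ*C` at `w`
  (in `w`-primitive coordinates `|F(y₀,y₁)|_w, |G|_w, |F−G|_w ≤ 1`, and `|φ(y)|_w < 1`, `> 1`,
  `|φ(y) − 1|_w < 1` force `|F|_w`, `|G|_w`, resp. `|F−G|_w < 1`);
* `NFPoint.logCond_sub_logCondDiv_le` — **Prop. 1.7 (i), left inequality**:
  `log-cond_C(x) − log-cond_{φ*C}(y) ≤ log-diff(y) − log-diff(x)` for every presentation of `y`
  over an extension of the field of `x` (engine: `GenEllConductorDifferent`);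
* `NFPoint.logDiff_add_logCond_le_of_map` — the form the proof of Thm. 2.1 consumes (p. 13, with
  Prop. 1.6): `log-diff(x) + log-cond_C(x) ≤ log-diff(y) + log-cond_{φ*C}(y)
  ≤ log-diff(y) + 3n·ht(y) + log ‖f·g·(f−g)‖₁`.

NOT here: the right inequality `≲ (1 − 1/e)·log-cond_E` (needs exact tame / bounded wild local
differents and the Belyi hypothesis), part (ii) (Riemann–Hurwitz), curves other than `ℙ¹`
(`TODO(general form)` — the Thm. 2.1 proof needs `Y` of genus `≥ 2`).
-/

noncomputable section

open NumberField IsDedekindDomain Height Polynomial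

namespace Literature.NumberTheory.DiophantineGeometry.GenEll

/-- A finite map `φ = (F : G) : ℙ¹_ℚ → ℙ¹_ℚ` presented by `f = F(t,1)`, `g = G(t,1) ∈ ℤ[t]` and the
common degree `n` of the forms `F, G` (`deg f, deg g ≤ n`); `φ(y) = f(y)/g(y)` on `g(y) ≠ 0`.
[cite: MochizukiGenEll2010, Prop 1.7 p.9] -/
structure P1FiniteMap where
  /-- numerator `f` -/
  num : ℤ[X]
  /-- denominator `g` -/
  den : ℤ[X]
  /-- the degree `n` of the forms -/
  deg : ℕ
  /-- `deg f ≤ n` -/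
  natDegree_num_le : num.natDegree ≤ deg
  /-- `deg g ≤ n` -/
  natDegree_den_le : den.natDegree ≤ deg

namespace P1FiniteMap

/-- The pullback divisor `φ*C = V(F · G · (F − G)) ⊆ ℙ¹_ℤ` of `C = [0]+[1]+[∞]`, of degree `3n`; its
support over `Q̄` is `φ⁻¹({0, 1, ∞})`. [cite: MochizukiGenEll2010, Prop 1.7 p.9] -/
def pullbackCusps (φ : P1FiniteMap) : P1Divisor where
  poly := φ.num * φ.den * (φ.num - φ.den)
  deg := 3 * φ.deg
  natDegree_le := by
    have h3 : (φ.num - φ.den).natDegree ≤ φ.deg :=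
      (natDegree_sub_le _ _).trans (max_le φ.natDegree_num_le φ.natDegree_den_le)
    calc (φ.num * φ.den * (φ.num - φ.den)).natDegree
        ≤ (φ.num * φ.den).natDegree + (φ.num - φ.den).natDegree := natDegree_mul_le
      _ ≤ (φ.num.natDegree + φ.den.natDegree) + (φ.num - φ.den).natDegree :=
          Nat.add_le_add_right natDegree_mul_le _
      _ ≤ (φ.deg + φ.deg) + φ.deg :=
          Nat.add_le_add (Nat.add_le_add φ.natDegree_num_le φ.natDegree_den_le) h3
      _ = 3 * φ.deg := by ring

end P1FiniteMap

namespace NFPoint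

variable (φ : P1FiniteMap)

/-- "`y ↦ x` under `φ`": the point `Q = y` is presented over an extension `ι : F_x → F_y` of the field
of `P = x`, `g(y) ≠ 0` and `f(y) = x · g(y)`, i.e. `x = φ(y)`. [cite: MochizukiGenEll2010, Prop 1.7 p.9] -/
structure MapsUnder (P Q : NFPoint) (ι : P.F →+* Q.F) : Prop where
  /-- `g(y) ≠ 0` -/
  den_ne_zero : aeval Q.x φ.den ≠ 0
  /-- `f(y) = ι(x) · g(y)` -/
  num_eq : aeval Q.x φ.num = ι P.x * aeval Q.x φ.den

variable {φ}

/-- If `x = φ(y)` lies in `U = ℙ¹ ∖ {0,1,∞}` then `y` lies off `supp φ*C` (`f(y) g(y) (f(y) − g(y)) ≠ 0`).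
[cite: MochizukiGenEll2010, Prop 1.7 p.9] -/
theorem offDiv_pullbackCusps {P Q : NFPoint} {ι : P.F →+* Q.F} (h : MapsUnder φ P Q ι)
    (hP : P.InU) : Q.OffDiv φ.pullbackCusps := by
  have hb := h.den_ne_zero
  have hx0 : ι P.x ≠ 0 := (map_ne_zero ι).mpr hP.1
  have hx1 : ι P.x ≠ 1 := fun h1 => hP.2 (ι.injective (by rw [h1, map_one]))
  simp only [OffDiv, P1FiniteMap.pullbackCusps, map_mul, map_sub, h.num_eq]
  refine mul_ne_zero (mul_ne_zero (mul_ne_zero hx0 hb) hb) ?_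
  rw [← sub_one_mul]
  exact mul_ne_zero (sub_ne_zero.mpr hx1) hb

/-! ## The geometric input: `x = φ(y)` meets `C` at `w` ⟹ `y` meets `φ*C` at `w` -/

/-- Real-number core: if `A, B, E ≤ c` are nonnegative and one of them is `< c`, then `A·B·E < c³`
(here `c > 0`). [folklore] -/
private theorem mul_mul_lt_of_le_of_lt {A B E c : ℝ} (hA : 0 ≤ A) (hB : 0 ≤ B) (hE : 0 ≤ E)
    (hc : 0 < c) (hAc : A ≤ c) (hBc : B ≤ c) (hEc : E ≤ c) (h : A < c ∨ B < c ∨ E < c) :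
    A * B * E < c * c * c := by
  have hcc : 0 < c * c := mul_pos hc hc
  rcases h with h | h | h
  · have hBE : B * E ≤ c * c := mul_le_mul hBc hEc hE hc.le
    calc A * B * E = A * (B * E) := by ring
      _ ≤ A * (c * c) := mul_le_mul_of_nonneg_left hBE hA
      _ < c * (c * c) := mul_lt_mul_of_pos_right h hcc
      _ = c * c * c := by ring
  · have hAE : A * E ≤ c * c := mul_le_mul hAc hEc hE hc.le
    calc A * B * E = B * (A * E) := by ring
      _ ≤ B * (c * c) := mul_le_mul_of_nonneg_left hAE hB
      _ < c * (c * c) := mul_lt_mul_of_pos_right h hcc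
      _ = c * c * c := by ring
  · have hAB : A * B ≤ c * c := mul_le_mul hAc hBc hB hc.le
    calc A * B * E = E * (A * B) := by ring
      _ ≤ E * (c * c) := mul_le_mul_of_nonneg_left hAB hE
      _ < c * (c * c) := mul_lt_mul_of_pos_right h hcc
      _ = c * c * c := by ring

/-- `|z|_w < 1` in terms of the valuation. [folklore] -/
private theorem mk_lt_one_iff {F : Type*} [Field F] [NumberField F] (w : HeightOneSpectrum (𝓞 F))
    (z : F) : FinitePlace.mk w z < 1 ↔ w.valuation F z < 1 := by
  have hmono := WithZeroMulInt.toNNReal_strictMono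
    (NumberField.HeightOneSpectrum.one_lt_absNorm_nnreal w)
  rw [FinitePlace.mk_apply, FinitePlace.norm_embedding', ← NNReal.coe_one, NNReal.coe_lt_coe,
    ← map_one (WithZeroMulInt.toNNReal (NumberField.HeightOneSpectrum.absNorm_ne_zero w)),
    hmono.lt_iff_lt]

/-- `1 < |z|_w` in terms of the valuation. [folklore] -/
private theorem one_lt_mk_iff {F : Type*} [Field F] [NumberField F] (w : HeightOneSpectrum (𝓞 F))
    (z : F) : 1 < FinitePlace.mk w z ↔ 1 < w.valuation F z := by
  have hmono := WithZeroMulInt.toNNReal_strictMono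
    (NumberField.HeightOneSpectrum.one_lt_absNorm_nnreal w)
  rw [FinitePlace.mk_apply, FinitePlace.norm_embedding', ← NNReal.coe_one, NNReal.coe_lt_coe,
    ← map_one (WithZeroMulInt.toNNReal (NumberField.HeightOneSpectrum.absNorm_ne_zero w)),
    hmono.lt_iff_lt]

/-- **Geometric input of Prop. 1.7 (i) for `φ : ℙ¹ → ℙ¹`.** Let `x = φ(y)` with `y` presented over an
extension `ι : F_x → F_y`, and let `w` be a prime of `F_y` whose restriction `w ∩ 𝓞_{F_x}` lies in the
support of the conductor of `x` at `C = [0]+[1]+[∞]`. Then `w` lies in the support of the conductor of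
`y` at `φ*C`. No hypothesis on the prime `w` (no exceptional set) and none on the ramification of
`φ`. [cite: MochizukiGenEll2010, Prop 1.7 (i) p.9] -/
theorem mem_condSupportDiv_pullbackCusps {P Q : NFPoint} {ι : P.F →+* Q.F} (h : MapsUnder φ P Q ι)
    (w : HeightOneSpectrum (𝓞 Q.F))
    (hw : letI : Algebra P.F Q.F := ι.toAlgebra; w.under (𝓞 P.F) ∈ P.condSupport) :
    w ∈ Q.condSupportDiv φ.pullbackCusps := by
  letI : Algebra P.F Q.F := ι.toAlgebra
  set v : HeightOneSpectrum (𝓞 P.F) := w.under (𝓞 P.F) with hv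
  haveI : w.asIdeal.LiesOver v.asIdeal := ⟨rfl⟩
  have he : v.asIdeal.ramificationIdx' w.asIdeal ≠ 0 :=
    Ideal.IsDedekindDomain.ramificationIdx'_ne_zero_of_liesOver w.asIdeal v.ne_bot
  -- transport the three conditions on `x` at `v` to conditions on `ι x` at `w`
  have hlies : ∀ z : P.F, v.valuation P.F z ^ v.asIdeal.ramificationIdx' w.asIdeal =
      w.valuation Q.F (ι z) := fun z => HeightOneSpectrum.valuation_liesOver Q.F v w z
  have hlt : ∀ z : P.F, v.valuation P.F z < 1 → w.valuation Q.F (ι z) < 1 := fun z hz => by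
    rw [← hlies z]; exact pow_lt_one₀ zero_le hz he
  have hgt : ∀ z : P.F, 1 < v.valuation P.F z → 1 < w.valuation Q.F (ι z) := fun z hz => by
    rw [← hlies z]; exact one_lt_pow₀ hz he
  -- the real absolute values at `w` of `a = f(y)`, `b = g(y)`, `a − b`, and `c = max(|y|_w, 1)^n`
  set a : Q.F := aeval Q.x φ.num with ha_def
  set b : Q.F := aeval Q.x φ.den with hb_def
  have hb : b ≠ 0 := h.den_ne_zero
  have hab : a = ι P.x * b := h.num_eq
  set μ := FinitePlace.mk w with hμ
  set c : ℝ := max (μ Q.x) 1 ^ φ.deg with hc_def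
  have hc : 0 < c := pow_pos (lt_of_lt_of_le zero_lt_one (le_max_right _ _)) _
  have hAc : μ a ≤ c := finitePlace_aeval_le μ φ.num φ.natDegree_num_le Q.x
  have hBc : μ b ≤ c := finitePlace_aeval_le μ φ.den φ.natDegree_den_le Q.x
  have hEc : μ (a - b) ≤ c := by
    have : a - b = aeval Q.x (φ.num - φ.den) := by rw [map_sub]
    rw [this]
    exact finitePlace_aeval_le μ _ ((natDegree_sub_le _ _).trans
      (max_le φ.natDegree_num_le φ.natDegree_den_le)) Q.x
  have hBpos : 0 < μ b := FinitePlace.pos_iff.mpr hb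
  -- one of the three is `< c`
  have hone : μ a < c ∨ μ b < c ∨ μ (a - b) < c := by
    rcases hw with h0 | h0 | h0
    · -- `|x|_v < 1`: `|a|_w = |x|_w |b|_w < |b|_w ≤ c`
      left
      have hx : μ (ι P.x) < 1 := (mk_lt_one_iff w _).mpr (hlt _ h0)
      calc μ a = μ (ι P.x) * μ b := by rw [hab, map_mul]
        _ < 1 * μ b := mul_lt_mul_of_pos_right hx hBpos
        _ ≤ c := by rw [one_mul]; exact hBc
    · -- `|x|_v > 1`: `|b|_w < |a|_w ≤ c`
      right; left
      have hx : 1 < μ (ι P.x) := (one_lt_mk_iff w _).mpr (hgt _ h0)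
      calc μ b = 1 * μ b := (one_mul _).symm
        _ < μ (ι P.x) * μ b := mul_lt_mul_of_pos_right hx hBpos
        _ = μ a := by rw [hab, map_mul]
        _ ≤ c := hAc
    · -- `|x − 1|_v < 1`: `|a − b|_w = |x − 1|_w |b|_w < |b|_w ≤ c`
      right; right
      have hx : μ (ι P.x - 1) < 1 := by
        have := (mk_lt_one_iff w (ι (P.x - 1))).mpr (hlt _ h0)
        rwa [map_sub, map_one] at this
      calc μ (a - b) = μ (ι P.x - 1) * μ b := by rw [hab, ← sub_one_mul, map_mul]
        _ < 1 * μ b := mul_lt_mul_of_pos_right hx hBpos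
        _ ≤ c := by rw [one_mul]; exact hBc
  -- conclude
  have hpoly : aeval Q.x φ.pullbackCusps.poly = a * b * (a - b) := by
    simp only [P1FiniteMap.pullbackCusps, map_mul, map_sub, ha_def, hb_def]
  rw [mem_condSupportDiv_iff_mk, hpoly, ← hμ, map_mul μ, map_mul μ,
    show max (μ Q.x) 1 ^ φ.pullbackCusps.deg = c * c * c by
      rw [show φ.pullbackCusps.deg = φ.deg * 3 from mul_comm _ _, pow_mul, ← hc_def]; ring]
  exact mul_mul_lt_of_le_of_lt (apply_nonneg _ _) (apply_nonneg _ _) (apply_nonneg _ _) hc hAc hBc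
    hEc hone

/-! ## Prop. 1.7 (i), left inequality -/

/-- The log-conductor at `C` as a finite sum over the support. [cite: MochizukiGenEll2010, Def 1.5 (iv) p.8] -/
theorem logCond_eq_sum (P : NFPoint) (hP : P.InU) :
    P.logCond = (P.degree : ℝ)⁻¹ *
      ∑ v ∈ (P.condSupport_finite hP).toFinset, Real.log (Ideal.absNorm v.asIdeal : ℝ) := by
  rw [logCond, finprod_mem_eq_finite_toFinset_prod _ (P.condSupport_finite hP), Nat.cast_prod,
    Real.log_prod]
  exact fun v _ => Nat.cast_ne_zero.mpr (by rw [Ne, Ideal.absNorm_eq_zero_iff]; exact v.ne_bot)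

/-- The log-conductor at a divisor `D` as a finite sum over the support.
[cite: MochizukiGenEll2010, Def 1.5 (iv) p.8] -/
theorem logCondDiv_eq_sum {D : P1Divisor} (Q : NFPoint) (hQ : Q.OffDiv D) :
    Q.logCondDiv D = (Q.degree : ℝ)⁻¹ *
      ∑ w ∈ (Q.condSupportDiv_finite hQ).toFinset, Real.log (Ideal.absNorm w.asIdeal : ℝ) := by
  rw [logCondDiv, finprod_mem_eq_finite_toFinset_prod _ (Q.condSupportDiv_finite hQ),
    Nat.cast_prod, Real.log_prod]
  exact fun v _ => Nat.cast_ne_zero.mpr (by rw [Ne, Ideal.absNorm_eq_zero_iff]; exact v.ne_bot)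

/-- **[GenEll] Proposition 1.7 (i), left inequality, for `φ : ℙ¹ → ℙ¹` and `E = C`**: if `x = φ(y)`
(`y` presented over an extension of the field of `x`) and `x ∈ U = ℙ¹ ∖ {0,1,∞}`, then
`log-cond_C(x) − log-cond_{φ*C}(y) ≤ log-diff(y) − log-diff(x)` — the printed
`log-cond_E − log-cond_D ≲ log-diff_Y − log-diff_Z` with constant `0`. Proof: the geometric input
`mem_condSupportDiv_pullbackCusps` feeds the conductor–different inequality
`NFPoint.cond_sub_cond_le_logDiff_sub_logDiff`. [cite: MochizukiGenEll2010, Prop 1.7 (i) p.9] -/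
theorem logCond_sub_logCondDiv_le {P Q : NFPoint} {ι : P.F →+* Q.F} (h : MapsUnder φ P Q ι)
    (hP : P.InU) :
    P.logCond - Q.logCondDiv φ.pullbackCusps ≤ Q.logDiff - P.logDiff := by
  have hQ : Q.OffDiv φ.pullbackCusps := offDiv_pullbackCusps h hP
  rw [P.logCond_eq_sum hP, Q.logCondDiv_eq_sum hQ]
  refine NFPoint.cond_sub_cond_le_logDiff_sub_logDiff P Q ι _ _ fun w hw => ?_
  rw [Set.Finite.mem_toFinset] at hw ⊢
  exact mem_condSupportDiv_pullbackCusps h w hw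

/-- **The form consumed by the proof of [GenEll] Thm. 2.1** (p. 13: "apply Proposition 1.7, (i) … to
conclude that `log-diff_P + log-cond_C ≲ log-diff_X + log-cond_E`", then Prop. 1.6
"`log-cond_E ≲ ht_E`"), for `X = ℙ¹`: `log-diff(x) + log-cond_C(x) ≤ log-diff(y) + log-cond_{φ*C}(y)
≤ log-diff(y) + 3n · ht(y) + log ‖f g (f − g)‖₁`. [cite: MochizukiGenEll2010, Thm 2.1 p.13] -/
theorem logDiff_add_logCond_le_of_map {P Q : NFPoint} {ι : P.F →+* Q.F} (h : MapsUnder φ P Q ι)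
    (hP : P.InU) :
    P.logDiff + P.logCond ≤
      Q.logDiff + (3 * φ.deg : ℕ) * Q.ht + Real.log φ.pullbackCusps.coeffSum := by
  have h1 := logCond_sub_logCondDiv_le h hP
  have h2 := Q.logCondDiv_le (offDiv_pullbackCusps h hP)
  have h3 : (φ.pullbackCusps.deg : ℝ) = ((3 * φ.deg : ℕ) : ℝ) := rfl
  rw [h3] at h2
  linarith

end NFPoint

end Literature.NumberTheory.DiophantineGeometry.GenEll

end
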